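import Mathlib
import HarnessLib

/-!
# Fermat cycles — `(10, 69)`: kernel record of the VERTEX LEMMA's algebraic core (ENGINE v12.2, CSCROLL v2)

HONEST FRAMING: explicit algebraic cycles for specific Hodge classes on Fermat/Delsarte varieties;
residual open instances listed; no claim on general Hodge.

Cell `pub-hfermat`, track FIND-THE-CLASS, seat ftc-engine gen-14; companion of `ftc/certs/W69/CSCROLL.md` §7 (v2).  The
slot-level half of the CSCROLL classification (cones over twisted cubics INSIDE a carrier `V = {F = 0}`) rests on the VERTEX
LEMMA: a line `t ↦ p + t • w` contained in the hypersurface `{F = 0}` through a point `p` is tangent to it at `p`, i.e.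
`∑ i, w i * (∂F/∂yᵢ)(p) = 0`; hence if the lines of a cone through its vertex `p` span the ambient space, `p` is a singular
point of `F`.  This file records the algebraic identity behind it for an arbitrary polynomial `F` over a commutative ring:
the derivative at `t = 0` of `F (p + t • w)` is `∑ i, w i * (pderiv i F) (p)`, and it vanishes when `F (p + t • w) ≡ 0`.
Nothing here is a cycle, a class or a Hodge-theoretic statement: `(10,69)` is OPEN.
-/

namespace Summit.HodgeConjecture.FermatCycles.ConeVertexTangent

open MvPolynomial

variable {σ : Type*} {R : Type*} [CommRing R]

/-- The restriction of `F` to the parametrised line `t ↦ p + t • w`, as a univariate polynomial in `t`. -/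
noncomputable def lineRestrict (F : MvPolynomial σ R) (p w : σ → R) : Polynomial R :=
  MvPolynomial.aeval (fun i => Polynomial.C (p i) + Polynomial.C (w i) * Polynomial.X) F

/-- Restriction of a constant. -/
@[simp] theorem lineRestrict_C (a : R) (p w : σ → R) : lineRestrict (C a) p w = Polynomial.C a := by
  simp [lineRestrict]

/-- Restriction is additive. -/
@[simp] theorem lineRestrict_add (F G : MvPolynomial σ R) (p w : σ → R) :
    lineRestrict (F + G) p w = lineRestrict F p w + lineRestrict G p w := by
  simp [lineRestrict]

/-- Restriction of `F * X i` (the multiplicative step of the induction). -/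
@[simp] theorem lineRestrict_mul_X (F : MvPolynomial σ R) (i : σ) (p w : σ → R) :
    lineRestrict (F * X i) p w = lineRestrict F p w * (Polynomial.C (p i) + Polynomial.C (w i) * Polynomial.X) := by
  simp [lineRestrict]

/-- At `t = 0` the restricted polynomial takes the value `F p`. -/
theorem lineRestrict_eval_zero (F : MvPolynomial σ R) (p w : σ → R) :
    (lineRestrict F p w).eval 0 = MvPolynomial.eval p F := by
  induction F using MvPolynomial.induction_on with
  | C a => simp
  | add F G hF hG => simp [hF, hG]
  | mul_X F i hF => simp [hF, Polynomial.eval_add, Polynomial.eval_mul]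

/-- CHAIN RULE at `t = 0`: the derivative of `t ↦ F (p + t • w)` at `0` is `∑ i, w i * (pderiv i F)(p)`. -/
theorem derivative_lineRestrict_eval_zero [Fintype σ] [DecidableEq σ] (F : MvPolynomial σ R) (p w : σ → R) :
    (Polynomial.derivative (lineRestrict F p w)).eval 0 = ∑ i, w i * MvPolynomial.eval p (pderiv i F) := by
  induction F using MvPolynomial.induction_on with
  | C a => simp
  | add F G hF hG =>
      simp only [lineRestrict_add, Polynomial.eval_add, hF, hG, map_add, mul_add, Finset.sum_add_distrib]
  | mul_X F i hF =>
      rw [lineRestrict_mul_X, Polynomial.derivative_mul, Polynomial.eval_add, Polynomial.eval_mul,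
        Polynomial.eval_mul, hF, lineRestrict_eval_zero]
      have hd : Polynomial.derivative (Polynomial.C (p i) + Polynomial.C (w i) * Polynomial.X) = Polynomial.C (w i) := by
        simp
      rw [hd]
      simp only [Polynomial.eval_add, Polynomial.eval_C, Polynomial.eval_mul, Polynomial.eval_X, mul_zero, add_zero]
      -- right-hand side: pderiv of a product
      have hr : ∀ j, MvPolynomial.eval p (pderiv j (F * X i)) =
          p i * MvPolynomial.eval p (pderiv j F) + MvPolynomial.eval p F * (if i = j then 1 else 0) := by
        intro j
        rw [(pderiv j).leibniz F (X i), pderiv_X]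
        simp only [smul_eq_mul, map_add, map_mul, MvPolynomial.eval_X, Pi.single_apply, apply_ite (MvPolynomial.eval p),
          map_one, map_zero]
        split_ifs <;> ring
      simp_rw [hr, mul_add, Finset.sum_add_distrib]
      congr 1
      · rw [Finset.sum_mul]
        exact Finset.sum_congr rfl fun j _ => by ring
      · rw [Finset.sum_eq_single i (fun j _ hj => by simp [Ne.symm hj]) (fun h => absurd (Finset.mem_univ i) h)]
        simp [mul_comm]

/-- VERTEX LEMMA (algebraic core): if the whole line `t ↦ p + t • w` lies in the hypersurface `{F = 0}`
(`F (p + t • w) ≡ 0` as a polynomial in `t`), then `w` is tangent to it at `p`: `∑ i, w i * (∂F/∂yᵢ)(p) = 0`. -/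
theorem tangent_of_line_subset [Fintype σ] [DecidableEq σ] {F : MvPolynomial σ R} {p w : σ → R}
    (h : lineRestrict F p w = 0) :
    ∑ i, w i * MvPolynomial.eval p (pderiv i F) = 0 := by
  rw [← derivative_lineRestrict_eval_zero, h, Polynomial.derivative_zero, Polynomial.eval_zero]

/-- Consequently, at a SMOOTH point `p` (some partial derivative non-zero) every direction `w` of a line of `{F = 0}` through
`p` satisfies one fixed non-trivial linear equation — the lines through `p` lie in the tangent hyperplane and cannot span the
ambient space; a cone over a curve spanning a hyperplane complementary to `p` therefore has its vertex in the singular locus. -/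
theorem exists_linear_relation_of_smooth [Fintype σ] [DecidableEq σ] {F : MvPolynomial σ R} {p : σ → R}
    (hp : ∃ i, MvPolynomial.eval p (pderiv i F) ≠ 0) :
    ∃ ℓ : σ → R, ℓ ≠ 0 ∧ ∀ w : σ → R, lineRestrict F p w = 0 → ∑ i, w i * ℓ i = 0 := by
  refine ⟨fun i => MvPolynomial.eval p (pderiv i F), ?_, fun w hw => tangent_of_line_subset hw⟩
  obtain ⟨i, hi⟩ := hp
  intro h
  exact hi (congrFun h i)

end Summit.HodgeConjecture.FermatCycles.ConeVertexTangent
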